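import Summits.RiemannHypothesis.RiemannHypothesis.Theorems.GapsEvoDoorsSincTransform
import Summits.RiemannHypothesis.RiemannHypothesis.Theses.GapsEvoDoors

/-!
# GapsEvoDoors — the sinc⁴ witness: the exact certificate at `(Δ, ε, λ) = (2, 1/100, 49/100)`

Cell rh-gaps (D-0143/D-0145), engine EVO-TF-1 (eng-1 g2). Item stmt-RiemannHypothesis-22421
`DeltaCIFinite` was CLOSED AS PROVED by `Theorems.GapsEvoDoorsDeltaCI.DeltaCIFinite_holds`
(prover-1, dilated BGMM Selberg minorant at `(100/49, 1/20, 49/100)`) while this genus-disjoint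
witness was being filed; this file therefore lands as a `--supports` record and does NOT restate the
route decl: it proves the certificate clauses for the engine's band-limited witness
`r(u) = (1 − u²/λ²)·sinc(πu)⁴` at the INTEGER window `Δ = 2` and assembles them in a kernel-checked
`example : …Theses.GapsEvoDoors.DeltaCIFinite` (second, code- and genus-disjoint closure of the same
∃; D-0143 two-engine habit carried into the kernel).

With `r̂ = witnessHat` (file `GapsEvoDoorsSincTransform`): `r̂(0) = 2/3 − 2μ`,
`∫₀¹ α r̂(α) dα = 11/60`, and on `[1, 2]` (where `r̂ = pieceB ≥ 0`)
`∫₁² ((1−ε) r̂⁺ − (1+ε) r̂⁻) = (1−ε)(1/24 + μ/2)`; so `c(r; 2, ε) = 7/60 − ε/12 − (1+ε)μ`,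
`μ = 1/(4π²λ²)`, i.e. `c > 0 ⟺ π² > 15(1+ε)/((7−5ε)λ²)`; at `(ε, λ) = (1/100, 49/100)`:
`c = 139/1200 − (101/100)μ = 0.009280 (float; planner cross-check ≡) > 0 ⟸ π > 3.14`
(`c(2, 0; λ) > 0 ⟺ λ > √(15/(7π²)) = 0.46597`). Informal reading (the route's chain, NOT proved
here): RH + «F(α,T) → 1 on 1 < |α| ≤ 2» ⇒ a positive proportion of consecutive-zero spacings
≤ 0.49 mean spacings (`FFSpacingCriterionAll`, 22422) ⇒ Conrey–Iwaniec (1.22) (`SpacingToCI`,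
22423). computed ≠ proved for every engine number quoted; nothing here bears on the truth of RH.
-/

noncomputable section

open Real MeasureTheory Set Filter Topology
open scoped FourierTransform
open Literature.NumberTheory.LFunctions Literature.NumberTheory.LFunctions.BGMM2023

set_option linter.dupNamespace false  -- the mandated namespace repeats `RiemannHypothesis`

namespace Summit.RiemannHypothesis.RiemannHypothesis.Theorems.GapsEvoDoorsSinc

/-! ## The certificate -/

/-- `primXA' = x · pieceA`. -/
theorem hasDerivAt_primXA (x : ℝ) : HasDerivAt primXA (x * pieceA x) x := by
  have h := (((((hasDerivAt_id' x).fun_pow 2).div_const 3).fun_sub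
    (((hasDerivAt_id' x).fun_pow 4).div_const 4)).fun_add
    (((hasDerivAt_id' x).fun_pow 5).div_const 10)).fun_add
    ((((hasDerivAt_id' x).fun_pow 3).fun_sub ((hasDerivAt_id' x).fun_pow 2)).const_mul mu)
  exact h.congr_deriv (by unfold pieceA; push_cast; ring)

/-- `∫₀¹ α r̂(α) dα = 11/60`. -/
theorem integral_mul_witnessHat : ∫ a in (0 : ℝ)..1, a * witnessHat a = 11 / 60 := by
  have h : ∫ a in (0 : ℝ)..1, a * witnessHat a = ∫ a in (0 : ℝ)..1, a * pieceA a := by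
    refine intervalIntegral.integral_congr fun x hx ↦ ?_
    rw [Set.uIcc_of_le zero_le_one] at hx
    simp only [witnessHat_eq_pieceA hx.1 hx.2]
  rw [h, intervalIntegral.integral_eq_sub_of_hasDerivAt (fun x _ ↦ hasDerivAt_primXA x)
    ((continuous_id.mul continuous_pieceA).intervalIntegrable _ _)]
  unfold primXA
  ring

/-- `∫₁² ((1−ε) r̂⁺ − (1+ε) r̂⁻) = (1−ε)(1/24 + μ/2)` at `ε = 1/100` (`r̂ ≥ 0` on `[1, 2]`). -/
theorem integral_max_witnessHat :
    ∫ a in (1 : ℝ)..2, ((1 - 1 / 100) * max (witnessHat a) 0 - (1 + 1 / 100) * max (-witnessHat a)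
0)
      = (1 - 1 / 100) * (1 / 24 + mu / 2) := by
  have h : ∫ a in (1 : ℝ)..2, ((1 - 1 / 100) * max (witnessHat a) 0 - (1 + 1 / 100) *
      max (-witnessHat a) 0) = ∫ a in (1 : ℝ)..2, (1 - 1 / 100) * pieceB a := by
    refine intervalIntegral.integral_congr fun x hx ↦ ?_
    rw [Set.uIcc_of_le one_le_two] at hx
    have h0 : 0 ≤ pieceB x := pieceB_nonneg hx.2
    simp only [witnessHat_eq_pieceB hx.1 hx.2, max_eq_left h0, max_eq_right (neg_nonpos.2 h0),
      mul_zero, sub_zero]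
  rw [h, intervalIntegral.integral_const_mul, integral_pieceB]

/-- `r̂ ≥ 0` beyond the window `Δ = 2` (indeed `r̂ = 0` there). -/
theorem sinc_witness_transform_nonneg {a : ℝ} (ha : 2 ≤ |a|) : 0 ≤ cosTransform witness a := by
  rw [cosTransform_witness, witnessHat_eq_zero ha]

/-- `r̂ ∈ L¹`. -/
theorem sinc_witness_transform_integrable : Integrable (cosTransform witness) := by
  rw [cosTransform_witness]; exact witnessHat_integrable

/-- **The exact certificate**: `c(r; 2, 1/100) = 139/1200 − (101/100)μ`, `μ = 1/(4π²λ²)`. -/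
theorem sinc_witness_certificate_eq :
    cosTransform witness 0 - 1 + 2 * (∫ α in (0 : ℝ)..1, α * cosTransform witness α) +
      2 * (∫ α in (1 : ℝ)..2, ((1 - 1 / 100) * max (cosTransform witness α) 0 -
        (1 + 1 / 100) * max (-cosTransform witness α) 0)) = 139 / 1200 - 101 / 100 * mu := by
  rw [cosTransform_witness, witnessHat_zero, integral_mul_witnessHat, integral_max_witnessHat]
  ring

/-- **Positivity of the certificate** (`⟸ π > 3.14`; float value `0.009280`). -/
theorem sinc_witness_certificate_pos :
    0 < cosTransform witness 0 - 1 + 2 * (∫ α in (0 : ℝ)..1, α * cosTransform witness α) +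
      2 * (∫ α in (1 : ℝ)..2, ((1 - 1 / 100) * max (cosTransform witness α) 0 -
        (1 + 1 / 100) * max (-cosTransform witness α) 0)) := by
  rw [sinc_witness_certificate_eq]
  unfold mu lam
  have hπ : (3.14 : ℝ) < π := Real.pi_gt_d2
  have hπ2 : (9.8596 : ℝ) < π ^ 2 := by nlinarith
  have hden : (0 : ℝ) < 4 * π ^ 2 * (49 / 100) ^ 2 := by positivity
  have ht : 1 / (4 * π ^ 2 * ((49 : ℝ) / 100) ^ 2) < 10561 / 100000 := by
    rw [div_lt_div_iff₀ hden (by norm_num)]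
    nlinarith
  nlinarith

/-- The clauses assemble to the route's ∃-statement (kernel-checked here as an `example`, since the
item is already closed by `GapsEvoDoorsDeltaCI.DeltaCIFinite_holds` and a second declaration of the
same statement would be a duplicate): witness `(2, 1/100, 49/100, r)`. -/
example : Summit.RiemannHypothesis.RiemannHypothesis.Theses.GapsEvoDoors.DeltaCIFinite :=
  ⟨2, 1 / 100, lam, witness, by norm_num, by norm_num, lam_bounds.1, lam_bounds.2, witness_neg,
    witness_continuous, witness_integrable, sinc_witness_transform_integrable, witness_le_one,
    fun _ hu ↦ witness_nonpos hu, fun _ ha ↦ sinc_witness_transform_nonneg ha,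
    sinc_witness_certificate_pos⟩

end Summit.RiemannHypothesis.RiemannHypothesis.Theorems.GapsEvoDoorsSinc

end
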